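import Literature.AlgebraicGeometry.Motives.GenericMumfordTateTypeStability
import Literature.AlgebraicGeometry.Motives.ZarhinHodgeGroupTypePP
import HarnessLib

/-!
# Hodge structures whose Mumford–Tate group has dimension `≤ 2`: the grading operator is a scalar, resp.
# the Mumford–Tate Lie algebra is `ℚ·id ⊕ ℚ·x` with `x_ℂ` an affine function of the grading operator

Family `hodge`, layer `Literature/AlgebraicGeometry/Motives`; THEOREMS ONLY (no definition, no named fact;
D-0026).  Abstract companion (pure `ℚ`-Hodge structures) of the cell `pub-hodgecm2` (COR-CM) lane MT-RANK-TWO,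
whose geometric file `Summits/HodgeConjecture/CorCM/MumfordTateRankTwo.lean` reads the results below on
`H¹` of a complex abelian variety.

Let `H` be a pure `ℚ`-Hodge structure of weight `n ≠ 0` on a finite-dimensional `V ≠ 0`, with
Mumford–Tate Lie algebra `𝔪𝔱 = H.mumfordTateLieAlgebra ⊆ End_ℚ V` (Deligne, LNM 900, I §3: the annihilator
of the Hodge tensors; `dim_ℚ 𝔪𝔱 = H.mtRank = dim MT(H)`), and let `e` be a graded basis of `V_ℂ` adapted to
`H` with degrees `deg` (`exists_basis_F_eq_span`), `Θ = gradingEnd e deg` the grading operator (`Θ = p` on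
`V^{p,q}`).  Two inputs of the tree drive everything: `id ∈ 𝔪𝔱` (`id_mem_mumfordTateLieAlgebra`, `n ≠ 0`)
and `Θ ∈ ℂ ⊗ 𝔪𝔱` (`gradingEnd_mem_span_lieStabilizer`, Deligne I 3.4: `μ(𝔾ₘ) ⊆ MT_ℂ`).

* §1 `gradingEnd_mem_span_pair_of_le` — if `𝔪𝔱 ⊆ span_ℚ {id, x}` then `Θ = α·id + β·x_ℂ`.
* §2 `deg_eq_deg_of_mtRank_eq_one` — **`dim MT(H) = 1` forces `Θ` to be a scalar**: all Hodge degrees agree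
  (`V_ℂ = V^{p₀,n-p₀}`); `two_mul_deg_eq_of_forall_deg_eq` — a Hodge structure concentrated in one bidegree has
  EVEN weight `n = 2p₀`; hence **`two_le_mtRank_of_odd`: `2 ≤ dim MT(H)` for every non-zero Hodge structure of
  odd weight**, and `two_le_mtRank_of_piece_ne_bot` (two distinct non-zero Hodge pieces).
* §3 **`dim MT(H) = 2`** (`exists_of_mtRank_eq_two`, `exists_of_mtRank_eq_two_of_odd`): there is
  `x ∈ 𝔪𝔱` with `𝔪𝔱 = span_ℚ {id, x}`, `![id, x]` linearly independent, and complex numbers `a`, `b ≠ 0` with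
  `x_ℂ (e σ) = (a + b · deg σ) • e σ` for every graded basis vector — `x_ℂ` is diagonal in EVERY adapted basis,
  with eigenvalue an injective affine function of the Hodge degree; consequently `x_ℂ` acts on `V^{p,n-p}` by
  `a + b p` (`baseChange_apply_eq_smul_of_mem_piece`) and `x` is a Hodge endomorphism
  (`map_F_le_of_apply_basis`, `x ∈ H.endAlg`).  On `H¹` of an abelian variety (two degrees `0, 1`) this makes
  `ℚ[x]` an imaginary quadratic field acting with `H^{1,0}` and `H^{0,1}` as its two eigenspaces — the
  consumer's «`dim MT = 2 ⟺ power of a CM elliptic curve`».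

Proof idea (folklore; the Lie-algebra shadow of Deligne I 3.4/3.7): `ℂ ⊗ 𝔪𝔱 ∋ Θ`; if `𝔪𝔱 = ℚ·id` then
`Θ ∈ ℂ·id` is a scalar; if `𝔪𝔱 = ℚ·id ⊕ ℚ·x` then `Θ = α·id + β·x_ℂ` with `β ≠ 0` as soon as two Hodge degrees
occur, so `x_ℂ = β⁻¹(Θ − α)`.

## References

* [Deligne1982HodgeCycles] P. Deligne, *Hodge cycles on abelian varieties*, LNM 900 (1982), I §3, Prop. 3.4 (and
  its proof: `μ(𝔾ₘ) ⊆ MT_ℂ`), Example 3.7.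
* [GreenGriffithsKerr2012] M. Green, P. Griffiths, M. Kerr, *Mumford–Tate Groups and Domains* (2012), I.B,
  (I.B.1)–(I.B.5); V.B (CM Hodge structures).
* [Moonen1999HodgeLowDim] B. Moonen, Yu. Zarhin, *Hodge classes on abelian varieties of low dimension*, Math. Ann.
  315 (1999), §2 (Hodge group; `X` of CM type iff `Hg(X)` is commutative).
-/

noncomputable section

open scoped TensorProduct

namespace Literature.AlgebraicGeometry.Motives

namespace HodgeStructure

universe u

variable {V : Type u} [AddCommGroup V] [Module ℚ V] [Module.Finite ℚ V] [HodgeTensorFacts.{u, u}] {n : ℤ}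
  {S : Type u} [Fintype S] [DecidableEq S] {deg : S → ℤ}

/-! ## §1 The grading operator lies in the complex span of `𝔪𝔱` -/

/-- **`Θ ∈ ℂ ⊗ 𝔪𝔱`** in the `mumfordTateLieAlgebra` spelling: the grading operator of a graded basis adapted to
`H` lies in the complex span of the base changes of the elements of `H.mumfordTateLieAlgebra` (the tree's
`gradingEnd_mem_span_lieStabilizer` through `mumfordTateLieAlgebra_eq_lieStabilizer`; Deligne I, proof of
Prop. 3.4: `μ(𝔾ₘ) ⊆ MT(H)_ℂ`). [cite: Deligne1982HodgeCycles, I proof of Prop. 3.4] -/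
theorem gradingEnd_mem_span_baseChange_mumfordTateLieAlgebra (H : HodgeStructure V n)
    (e : Module.Basis S ℂ (ℂ ⊗[ℚ] V))
    (hF : ∀ a, H.F a = Submodule.span ℂ (e '' {σ | a ≤ deg σ}))
    (hFc : ∀ a, complexConj (H.F a) = Submodule.span ℂ (e '' {σ | deg σ ≤ n - a})) :
    gradingEnd e deg ∈ Submodule.span ℂ
      ((fun X : Module.End ℚ V => X.baseChange ℂ) '' (H.mumfordTateLieAlgebra : Set (Module.End ℚ V))) := by
  rw [mumfordTateLieAlgebra_eq_lieStabilizer]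
  exact gradingEnd_mem_span_lieStabilizer H e hF hFc

/-- **If `𝔪𝔱 ⊆ span_ℚ {id, x}` then `Θ = α·id + β·x_ℂ`** for some complex `α, β` (base change is `ℚ`-linear, so
the complex span of the base changes of `span_ℚ {id, x}` is `span_ℂ {id, x_ℂ}`). [cite: Deligne1982HodgeCycles, I proof of Prop. 3.4] -/
theorem gradingEnd_mem_span_pair_of_le (H : HodgeStructure V n) (e : Module.Basis S ℂ (ℂ ⊗[ℚ] V))
    (hF : ∀ a, H.F a = Submodule.span ℂ (e '' {σ | a ≤ deg σ}))
    (hFc : ∀ a, complexConj (H.F a) = Submodule.span ℂ (e '' {σ | deg σ ≤ n - a}))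
    {x : Module.End ℚ V}
    (hle : H.mumfordTateLieAlgebra ≤ Submodule.span ℚ {LinearMap.id, x}) :
    ∃ α β : ℂ, α • (LinearMap.id : Module.End ℂ (ℂ ⊗[ℚ] V)) + β • x.baseChange ℂ = gradingEnd e deg := by
  have h := gradingEnd_mem_span_baseChange_mumfordTateLieAlgebra H e hF hFc
  have hsub : (fun X : Module.End ℚ V => X.baseChange ℂ) '' (H.mumfordTateLieAlgebra : Set (Module.End ℚ V)) ⊆
      (Submodule.span ℂ {(LinearMap.id : Module.End ℂ (ℂ ⊗[ℚ] V)), x.baseChange ℂ} :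
        Set (Module.End ℂ (ℂ ⊗[ℚ] V))) := by
    rintro _ ⟨X, hX, rfl⟩
    obtain ⟨a, b, hab⟩ := Submodule.mem_span_pair.1 (hle hX)
    change X.baseChange ℂ ∈ _
    rw [← hab, LinearMap.baseChange_add, LinearMap.baseChange_smul, LinearMap.baseChange_smul,
      LinearMap.baseChange_id]
    exact Submodule.add_mem _
      (Submodule.smul_of_tower_mem _ a (Submodule.subset_span (Set.mem_insert _ _)))
      (Submodule.smul_of_tower_mem _ b (Submodule.subset_span (Set.mem_insert_of_mem _ rfl)))
  exact Submodule.mem_span_pair.1 ((Submodule.span_le.2 hsub) h)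

omit [Module.Finite ℚ V] [HodgeTensorFacts.{u, u}] [Fintype S] [DecidableEq S] in
/-- If `Θ = α·id` is a scalar then all degrees of the graded basis agree (`Θ (e σ) = deg σ • e σ`). [folklore] -/
private theorem deg_eq_deg_of_gradingEnd_eq_smul_id [Fintype S] [DecidableEq S] (e : Module.Basis S ℂ (ℂ ⊗[ℚ] V))
    {α : ℂ} (h : gradingEnd e deg = α • (LinearMap.id : Module.End ℂ (ℂ ⊗[ℚ] V))) (σ τ : S) :
    deg σ = deg τ := by
  have key : ∀ ρ : S, (deg ρ : ℂ) = α := by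
    intro ρ
    have h1 := gradingEnd_apply_basis e deg ρ
    rw [h, LinearMap.smul_apply, LinearMap.id_apply] at h1
    have h2 : ((deg ρ : ℂ) - α) • e ρ = 0 := by rw [sub_smul, ← h1, sub_self]
    rcases smul_eq_zero.1 h2 with h3 | h3
    · exact (sub_eq_zero.1 h3)
    · exact absurd h3 (e.ne_zero ρ)
  exact_mod_cast (key σ).trans (key τ).symm

/-! ## §2 `dim MT(H) = 1`: the grading operator is a scalar; odd weight forces `dim MT(H) ≥ 2` -/

/-- **`dim MT(H) = 1` forces all Hodge degrees to agree.**  If `n ≠ 0` (so `id ∈ 𝔪𝔱`) and `dim_ℚ 𝔪𝔱 = 1`,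
then `𝔪𝔱 = ℚ·id`, `Θ ∈ ℂ·id`, and `deg` is constant on every graded basis adapted to `H`: the Hodge structure is
concentrated in one bidegree `V_ℂ = V^{p₀, n-p₀}`. [cite: Deligne1982HodgeCycles, I Prop. 3.4 (proof)] -/
theorem deg_eq_deg_of_mtRank_eq_one [Nontrivial V] (H : HodgeStructure V n) (hn : n ≠ 0) (h1 : H.mtRank = 1)
    (e : Module.Basis S ℂ (ℂ ⊗[ℚ] V))
    (hF : ∀ a, H.F a = Submodule.span ℂ (e '' {σ | a ≤ deg σ}))
    (hFc : ∀ a, complexConj (H.F a) = Submodule.span ℂ (e '' {σ | deg σ ≤ n - a})) (σ τ : S) :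
    deg σ = deg τ := by
  set L := H.mumfordTateLieAlgebra with hL
  have hid : (LinearMap.id : Module.End ℚ V) ∈ L := H.id_mem_mumfordTateLieAlgebra hn
  let v : L := ⟨LinearMap.id, hid⟩
  have hv : v ≠ 0 := fun h => one_ne_zero (congrArg Subtype.val h : (LinearMap.id : Module.End ℚ V) = 0)
  have h1' : Module.finrank ℚ L = 1 := h1
  have hle : L ≤ Submodule.span ℚ {LinearMap.id, (LinearMap.id : Module.End ℚ V)} := by
    intro y hy
    obtain ⟨c, hc⟩ := (finrank_eq_one_iff_of_nonzero' v hv).1 h1' ⟨y, hy⟩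
    have hc' : c • (LinearMap.id : Module.End ℚ V) = y := congrArg Subtype.val hc
    rw [← hc']
    exact Submodule.smul_mem _ c (Submodule.subset_span (Set.mem_insert _ _))
  obtain ⟨α, β, hαβ⟩ := gradingEnd_mem_span_pair_of_le H e hF hFc hle
  rw [LinearMap.baseChange_id, ← add_smul] at hαβ
  exact deg_eq_deg_of_gradingEnd_eq_smul_id e hαβ.symm σ τ

omit [Module.Finite ℚ V] [HodgeTensorFacts.{u, u}] [Fintype S] [DecidableEq S] in
/-- **A Hodge structure concentrated in one bidegree has even weight**: if every vector of a graded basis adapted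
to `H` has the same degree `p₀ = deg σ₀`, then `n = 2 p₀` (`F^{p₀} = V_ℂ`, so `conj F^{p₀} = V_ℂ = span {e σ |
deg σ ≤ n - p₀}` gives `p₀ ≤ n - p₀`; symmetrically `conj F^{n-p₀} = V_ℂ` gives `F^{n-p₀} = V_ℂ` and
`n - p₀ ≤ p₀`).  [cite: DeligneHodgeII1971, 1.2.5] -/
theorem two_mul_deg_eq_of_forall_deg_eq (H : HodgeStructure V n) (e : Module.Basis S ℂ (ℂ ⊗[ℚ] V))
    (hF : ∀ a, H.F a = Submodule.span ℂ (e '' {σ | a ≤ deg σ}))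
    (hFc : ∀ a, complexConj (H.F a) = Submodule.span ℂ (e '' {σ | deg σ ≤ n - a}))
    (σ₀ : S) (hdeg : ∀ σ, deg σ = deg σ₀) : n = 2 * deg σ₀ := by
  -- `F^{p₀} = ⊤`
  have hFtop : H.F (deg σ₀) = ⊤ := by
    rw [hF, eq_top_iff]
    rw [show {σ | deg σ₀ ≤ deg σ} = Set.univ from Set.eq_univ_of_forall fun σ => (hdeg σ).ge,
      Set.image_univ, e.span_eq]
  -- hence `conj F^{p₀} = ⊤ = span {e σ | deg σ ≤ n - p₀}`, so `p₀ ≤ n - p₀`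
  have h1 : deg σ₀ ≤ n - deg σ₀ := by
    have h := hFc (deg σ₀)
    rw [hFtop, complexConj_top] at h
    have hmem : e σ₀ ∈ Submodule.span ℂ (e '' {σ | deg σ ≤ n - deg σ₀}) := by rw [← h]; trivial
    exact e.self_mem_span_image.1 hmem
  -- `conj F^{n - p₀} = span {e σ | deg σ ≤ p₀} = ⊤`, hence `F^{n-p₀} = ⊤`, so `n - p₀ ≤ p₀`
  have h2 : n - deg σ₀ ≤ deg σ₀ := by
    have hc : complexConj (H.F (n - deg σ₀)) = ⊤ := by
      rw [hFc, sub_sub_cancel, eq_top_iff,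
        show {σ | deg σ ≤ deg σ₀} = Set.univ from Set.eq_univ_of_forall fun σ => (hdeg σ).le,
        Set.image_univ, e.span_eq]
    have hF' : H.F (n - deg σ₀) = ⊤ := by
      rw [← complexConj_complexConj (H.F (n - deg σ₀)), hc, complexConj_top]
    have hmem : e σ₀ ∈ Submodule.span ℂ (e '' {σ | n - deg σ₀ ≤ deg σ}) := by rw [← hF, hF']; trivial
    exact e.self_mem_span_image.1 hmem
  omega

omit [HodgeTensorFacts.{u, u}] [Fintype S] [DecidableEq S] in
/-- In odd weight a graded basis adapted to a non-zero Hodge structure has two vectors of different degrees.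
[cite: DeligneHodgeII1971, 1.2.5] -/
theorem exists_deg_ne_of_odd [Nontrivial V] (H : HodgeStructure V n) (hodd : Odd n)
    (e : Module.Basis S ℂ (ℂ ⊗[ℚ] V))
    (hF : ∀ a, H.F a = Submodule.span ℂ (e '' {σ | a ≤ deg σ}))
    (hFc : ∀ a, complexConj (H.F a) = Submodule.span ℂ (e '' {σ | deg σ ≤ n - a})) :
    ∃ σ τ : S, deg σ ≠ deg τ := by
  have hV : Nontrivial (ℂ ⊗[ℚ] V) := by
    apply Module.nontrivial_of_finrank_pos (R := ℂ)
    rw [Module.finrank_baseChange]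
    exact Module.finrank_pos
  obtain ⟨σ₀⟩ := e.index_nonempty
  by_contra h
  push Not at h
  have h2 := two_mul_deg_eq_of_forall_deg_eq H e hF hFc σ₀ fun σ => h σ σ₀
  exact (Int.not_even_iff_odd.2 hodd) ⟨deg σ₀, by rw [h2, two_mul]⟩

/-- **`2 ≤ dim MT(H)` for every non-zero Hodge structure of odd weight** (e.g. `H¹` of a non-zero complex
abelian variety): `dim MT(H) ≥ 1` by `id ∈ 𝔪𝔱`, and `dim MT(H) = 1` would make `Θ` a scalar, i.e. concentrate
`H` in a single bidegree, which has even weight. [cite: Deligne1982HodgeCycles, I Prop. 3.4 and Ex. 3.7] -/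
theorem two_le_mtRank_of_odd [Nontrivial V] (H : HodgeStructure V n) (hodd : Odd n) : 2 ≤ H.mtRank := by
  have hn : n ≠ 0 := fun h => (Int.not_even_iff_odd.2 hodd) ⟨0, by rw [h, add_zero]⟩
  have h1 : 0 < H.mtRank := H.mtRank_pos hn
  by_contra hlt
  have heq : H.mtRank = 1 := by omega
  obtain ⟨S, deg, e, hF, hFc⟩ := exists_basis_F_eq_span H
  haveI : Fintype S := FiniteDimensional.fintypeBasisIndex e
  classical
  obtain ⟨σ, τ, hστ⟩ := exists_deg_ne_of_odd H hodd e hF hFc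
  exact hστ (deg_eq_deg_of_mtRank_eq_one H hn heq e hF hFc σ τ)

/-- **`2 ≤ dim MT(H)` as soon as two distinct Hodge pieces are non-zero** (`n ≠ 0`): with `dim MT(H) = 1` the
grading operator would be a scalar on a graded basis containing vectors of both degrees.
[cite: Deligne1982HodgeCycles, I Prop. 3.4 (proof)] -/
theorem two_le_mtRank_of_piece_ne_bot [Nontrivial V] (H : HodgeStructure V n) (hn : n ≠ 0) {p p' : ℤ}
    (hpp' : p ≠ p') (hp : H.piece p (n - p) ≠ ⊥) (hp' : H.piece p' (n - p') ≠ ⊥) : 2 ≤ H.mtRank := by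
  have h1 : 0 < H.mtRank := H.mtRank_pos hn
  by_contra hlt
  have heq : H.mtRank = 1 := by omega
  obtain ⟨S, deg, e, hF, hFc⟩ := exists_basis_F_eq_span H
  haveI : Fintype S := FiniteDimensional.fintypeBasisIndex e
  classical
  have hex : ∀ q : ℤ, H.piece q (n - q) ≠ ⊥ → ∃ σ : S, deg σ = q := by
    intro q hq
    by_contra hno
    push Not at hno
    apply hq
    rw [piece_eq_span_of_graded H e hF hFc q,
      show {σ : S | deg σ = q} = ∅ from Set.eq_empty_of_forall_notMem fun σ hσ => hno σ hσ,
      Set.image_empty, Submodule.span_empty]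
  obtain ⟨σ, hσ⟩ := hex p hp
  obtain ⟨τ, hτ⟩ := hex p' hp'
  exact hpp' (hσ ▸ hτ ▸ deg_eq_deg_of_mtRank_eq_one H hn heq e hF hFc σ τ)

/-! ## §3 `dim MT(H) = 2`: `𝔪𝔱 = ℚ·id ⊕ ℚ·x` with `x_ℂ` affine in the grading operator -/

/-- With `n ≠ 0` and `dim_ℚ 𝔪𝔱 = 2` there is `x ∈ 𝔪𝔱` with `![id, x]` linearly independent and
`𝔪𝔱 ⊆ span_ℚ {id, x}` (extend `id ≠ 0` to a basis of the plane `𝔪𝔱`). [folklore] -/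
private theorem exists_pair_of_mtRank_eq_two [Nontrivial V] (H : HodgeStructure V n) (hn : n ≠ 0) (h2 : H.mtRank = 2) :
    ∃ x ∈ H.mumfordTateLieAlgebra, LinearIndependent ℚ ![(LinearMap.id : Module.End ℚ V), x] ∧
      H.mumfordTateLieAlgebra ≤ Submodule.span ℚ {LinearMap.id, x} := by
  set L := H.mumfordTateLieAlgebra with hL
  have hid : (LinearMap.id : Module.End ℚ V) ∈ L := H.id_mem_mumfordTateLieAlgebra hn
  let v : L := ⟨LinearMap.id, hid⟩
  have hv : v ≠ 0 := fun h => one_ne_zero (congrArg Subtype.val h : (LinearMap.id : Module.End ℚ V) = 0)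
  have h2' : Module.finrank ℚ L = 2 := h2
  obtain ⟨w, hvw⟩ := exists_linearIndependent_pair_of_one_lt_finrank (by rw [h2']; norm_num) hv
  refine ⟨w.1, w.2, ?_, ?_⟩
  · rw [LinearIndependent.pair_iff] at hvw ⊢
    intro s t hst
    refine hvw s t (Subtype.ext ?_)
    simpa using hst
  · have htop : Submodule.span ℚ (Set.range ![v, w]) = ⊤ :=
      hvw.span_eq_top_of_card_eq_finrank' (by rw [h2']; simp)
    intro y hy
    have hmem : (⟨y, hy⟩ : L) ∈ Submodule.span ℚ (Set.range ![v, w]) := by rw [htop]; trivial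
    rw [Matrix.range_cons, Matrix.range_cons, Matrix.range_empty, Set.union_empty,
      Set.singleton_union] at hmem
    obtain ⟨a, b, hab⟩ := Submodule.mem_span_pair.1 hmem
    have hab' : a • (LinearMap.id : Module.End ℚ V) + b • w.1 = y := by
      simpa using congrArg Subtype.val hab
    rw [← hab']
    exact Submodule.add_mem _ (Submodule.smul_mem _ a (Submodule.subset_span (Set.mem_insert _ _)))
      (Submodule.smul_mem _ b (Submodule.subset_span (Set.mem_insert_of_mem _ rfl)))

/-- **`dim MT(H) = 2`, basis form.**  If `n ≠ 0`, `dim_ℚ 𝔪𝔱 = 2`, and some graded basis `e` adapted to `H` has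
vectors of two different degrees, then there are `x ∈ 𝔪𝔱` with `𝔪𝔱 ⊆ span_ℚ {id, x}`, `![id, x]` independent,
and `a, b ∈ ℂ` with `b ≠ 0` such that **`x_ℂ (e σ) = (a + b·deg σ) • e σ`** for every `σ`: `Θ = α·id + β·x_ℂ`
with `β ≠ 0` (else `Θ` would be a scalar), so `x_ℂ = β⁻¹(Θ − α·id)`, `a = -α/β`, `b = 1/β`.
[cite: Deligne1982HodgeCycles, I Prop. 3.4 (proof) and Ex. 3.7] [cite: GreenGriffithsKerr2012, V.B] -/
theorem exists_of_mtRank_eq_two [Nontrivial V] (H : HodgeStructure V n) (hn : n ≠ 0) (h2 : H.mtRank = 2)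
    (e : Module.Basis S ℂ (ℂ ⊗[ℚ] V))
    (hF : ∀ a, H.F a = Submodule.span ℂ (e '' {σ | a ≤ deg σ}))
    (hFc : ∀ a, complexConj (H.F a) = Submodule.span ℂ (e '' {σ | deg σ ≤ n - a}))
    (hdeg : ∃ σ τ : S, deg σ ≠ deg τ) :
    ∃ x ∈ H.mumfordTateLieAlgebra, LinearIndependent ℚ ![(LinearMap.id : Module.End ℚ V), x] ∧
      H.mumfordTateLieAlgebra ≤ Submodule.span ℚ {LinearMap.id, x} ∧
      ∃ a b : ℂ, b ≠ 0 ∧ ∀ σ, x.baseChange ℂ (e σ) = (a + b * (deg σ : ℂ)) • e σ := by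
  obtain ⟨x, hx, hind, hle⟩ := exists_pair_of_mtRank_eq_two H hn h2
  obtain ⟨α, β, hαβ⟩ := gradingEnd_mem_span_pair_of_le H e hF hFc hle
  have hβ : β ≠ 0 := by
    intro hβ
    obtain ⟨σ, τ, hστ⟩ := hdeg
    rw [hβ, zero_smul, add_zero] at hαβ
    exact hστ (deg_eq_deg_of_gradingEnd_eq_smul_id e hαβ.symm σ τ)
  refine ⟨x, hx, hind, hle, -α / β, β⁻¹, inv_ne_zero hβ, fun σ => ?_⟩
  have h1 : β • x.baseChange ℂ (e σ) = ((deg σ : ℂ) - α) • e σ := by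
    have h := congrArg (fun T : Module.End ℂ (ℂ ⊗[ℚ] V) => T (e σ)) hαβ
    simp only [LinearMap.add_apply, LinearMap.smul_apply, LinearMap.id_apply, gradingEnd_apply_basis] at h
    rw [sub_smul, ← h, add_sub_cancel_left]
  have h2 : x.baseChange ℂ (e σ) = β⁻¹ • (((deg σ : ℂ) - α) • e σ) := by
    rw [← h1, smul_smul, inv_mul_cancel₀ hβ, one_smul]
  rw [h2, smul_smul]
  congr 1
  field_simp
  ring

/-- **`dim MT(H) = 2` in odd weight** (no degree hypothesis: two degrees occur automatically,
`exists_deg_ne_of_odd`). [cite: Deligne1982HodgeCycles, I Prop. 3.4 (proof) and Ex. 3.7] -/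
theorem exists_of_mtRank_eq_two_of_odd [Nontrivial V] (H : HodgeStructure V n) (hodd : Odd n)
    (h2 : H.mtRank = 2) (e : Module.Basis S ℂ (ℂ ⊗[ℚ] V))
    (hF : ∀ a, H.F a = Submodule.span ℂ (e '' {σ | a ≤ deg σ}))
    (hFc : ∀ a, complexConj (H.F a) = Submodule.span ℂ (e '' {σ | deg σ ≤ n - a})) :
    ∃ x ∈ H.mumfordTateLieAlgebra, LinearIndependent ℚ ![(LinearMap.id : Module.End ℚ V), x] ∧
      H.mumfordTateLieAlgebra ≤ Submodule.span ℚ {LinearMap.id, x} ∧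
      ∃ a b : ℂ, b ≠ 0 ∧ ∀ σ, x.baseChange ℂ (e σ) = (a + b * (deg σ : ℂ)) • e σ :=
  have hn : n ≠ 0 := fun h => (Int.not_even_iff_odd.2 hodd) ⟨0, by rw [h, add_zero]⟩
  exists_of_mtRank_eq_two H hn h2 e hF hFc (exists_deg_ne_of_odd H hodd e hF hFc)

omit [Module.Finite ℚ V] [HodgeTensorFacts.{u, u}] [Fintype S] [DecidableEq S] in
/-- **An operator diagonal in a graded basis, with eigenvalue a function of the degree, preserves the Hodge
filtration** (`F^p = span {e σ | p ≤ deg σ}`); applied to `x_ℂ` this says `x ∈ H.endAlg` is a Hodge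
endomorphism. [cite: Huybrechts2016K3, §3.3.3] -/
theorem map_F_le_of_apply_basis (H : HodgeStructure V n) (e : Module.Basis S ℂ (ℂ ⊗[ℚ] V))
    (hF : ∀ a, H.F a = Submodule.span ℂ (e '' {σ | a ≤ deg σ}))
    (Y : Module.End ℂ (ℂ ⊗[ℚ] V)) {f : ℤ → ℂ} (hY : ∀ σ, Y (e σ) = f (deg σ) • e σ) (p : ℤ) :
    (H.F p).map Y ≤ H.F p := by
  rw [hF, Submodule.map_span_le]
  rintro _ ⟨σ, hσ, rfl⟩
  rw [hY σ]
  exact Submodule.smul_mem _ _ (Submodule.subset_span ⟨σ, hσ, rfl⟩)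

omit [Module.Finite ℚ V] [HodgeTensorFacts.{u, u}] [Fintype S] [DecidableEq S] in
/-- The endomorphism `x` of §3 is a Hodge endomorphism: `x ∈ H.endAlg`. [cite: Huybrechts2016K3, §3.3.3] -/
theorem mem_endAlg_of_baseChange_apply_basis (H : HodgeStructure V n) (e : Module.Basis S ℂ (ℂ ⊗[ℚ] V))
    (hF : ∀ a, H.F a = Submodule.span ℂ (e '' {σ | a ≤ deg σ})) {x : Module.End ℚ V} {a b : ℂ}
    (hx : ∀ σ, x.baseChange ℂ (e σ) = (a + b * (deg σ : ℂ)) • e σ) : x ∈ H.endAlg :=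
  fun p => map_F_le_of_apply_basis H e hF (x.baseChange ℂ) (f := fun d => a + b * (d : ℂ)) hx p

omit [Module.Finite ℚ V] [HodgeTensorFacts.{u, u}] [Fintype S] [DecidableEq S] in
/-- Piece form of §3: **`x_ℂ` acts on `V^{p,n-p}` by the scalar `a + b p`**. [cite: Deligne1982HodgeCycles, I Ex. 3.7] -/
theorem baseChange_apply_eq_smul_of_mem_piece (H : HodgeStructure V n) (e : Module.Basis S ℂ (ℂ ⊗[ℚ] V))
    (hF : ∀ a, H.F a = Submodule.span ℂ (e '' {σ | a ≤ deg σ}))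
    (hFc : ∀ a, complexConj (H.F a) = Submodule.span ℂ (e '' {σ | deg σ ≤ n - a}))
    {x : Module.End ℚ V} {a b : ℂ} (hx : ∀ σ, x.baseChange ℂ (e σ) = (a + b * (deg σ : ℂ)) • e σ)
    (p : ℤ) {v : ℂ ⊗[ℚ] V} (hv : v ∈ H.piece p (n - p)) :
    x.baseChange ℂ v = (a + b * (p : ℂ)) • v :=
  apply_eq_smul_of_mem_piece_of_graded H e hF hFc (x.baseChange ℂ) (f := fun d => a + b * (d : ℂ)) hx p hv

/-! ## §4 Two bookkeeping facts for the consumer: effectivity bounds the degrees; conjugation of the eigenvalues -/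

omit [Module.Finite ℚ V] [HodgeTensorFacts.{u, u}] [Fintype S] [DecidableEq S] in
/-- In a graded basis adapted to an EFFECTIVE Hodge structure every degree lies in `[0, n]` (`e σ ∈ V^{deg σ,
n - deg σ} ≠ 0`). [cite: DeligneHodgeII1971, 2.1–2.2] -/
theorem IsEffective.deg_mem_Icc_of_graded {H : HodgeStructure V n} (hH : H.IsEffective)
    (e : Module.Basis S ℂ (ℂ ⊗[ℚ] V))
    (hF : ∀ a, H.F a = Submodule.span ℂ (e '' {σ | a ≤ deg σ}))
    (hFc : ∀ a, complexConj (H.F a) = Submodule.span ℂ (e '' {σ | deg σ ≤ n - a})) (σ : S) :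
    0 ≤ deg σ ∧ deg σ ≤ n := by
  have hne : H.piece (deg σ) (n - deg σ) ≠ ⊥ := by
    intro h
    have hmem := basis_mem_piece_of_graded H e hF hFc σ
    rw [h, Submodule.mem_bot] at hmem
    exact e.ne_zero σ hmem
  have h := hH _ _ hne
  omega

omit [Module.Finite ℚ V] [HodgeTensorFacts.{u, u}] [Fintype S] [DecidableEq S] in
/-- **Hodge symmetry of the eigenvalues.**  For a RATIONAL `x` whose base change is diagonal in a graded basis
with eigenvalue `a + b·deg`, the eigenvalues on `V^{p,n-p}` and on its conjugate `V^{n-p,p}` are complex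
conjugate: `conj (a + b p) = a + b (n - p)` whenever `V^{p,n-p} ≠ 0` (`x_ℂ` commutes with complex
conjugation, `conj_baseChange`, and `conj V^{p,q} = V^{q,p}`). [cite: Deligne1982HodgeCycles, §4 (conj V_σ = V_σ̄)] -/
theorem conj_eigenvalue_eq_of_piece_ne_bot (H : HodgeStructure V n) (e : Module.Basis S ℂ (ℂ ⊗[ℚ] V))
    (hF : ∀ a, H.F a = Submodule.span ℂ (e '' {σ | a ≤ deg σ}))
    (hFc : ∀ a, complexConj (H.F a) = Submodule.span ℂ (e '' {σ | deg σ ≤ n - a}))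
    {x : Module.End ℚ V} {a b : ℂ} (hx : ∀ σ, x.baseChange ℂ (e σ) = (a + b * (deg σ : ℂ)) • e σ)
    {p : ℤ} (hp : H.piece p (n - p) ≠ ⊥) :
    starRingEnd ℂ (a + b * (p : ℂ)) = a + b * ((n - p : ℤ) : ℂ) := by
  obtain ⟨v, hv, hv0⟩ := (Submodule.ne_bot_iff _).1 hp
  have h1 : x.baseChange ℂ v = (a + b * (p : ℂ)) • v :=
    baseChange_apply_eq_smul_of_mem_piece H e hF hFc hx p hv
  have hcv : conj v ∈ H.piece (n - p) (n - (n - p)) := by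
    rw [sub_sub_cancel]
    exact conj_mem_piece H hv
  have h2 : x.baseChange ℂ (conj v) = (a + b * ((n - p : ℤ) : ℂ)) • conj v :=
    baseChange_apply_eq_smul_of_mem_piece H e hF hFc hx (n - p) hcv
  have h3 : x.baseChange ℂ (conj v) = starRingEnd ℂ (a + b * (p : ℂ)) • conj v := by
    rw [← conj_baseChange, h1, conj_smul]
  have hcv0 : conj v ≠ 0 := fun h0 => hv0 (by rw [← conj_conj v, h0, map_zero])
  have h4 : (starRingEnd ℂ (a + b * (p : ℂ)) - (a + b * ((n - p : ℤ) : ℂ))) • conj v = 0 := by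
    rw [sub_smul, ← h3, ← h2, sub_self]
  rcases smul_eq_zero.1 h4 with h5 | h5
  · exact sub_eq_zero.1 h5
  · exact absurd h5 hcv0

end HodgeStructure

end Literature.AlgebraicGeometry.Motives

end
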